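import Summits.BirchSwinnertonDyer.Rank1Residual.X11b.BDPRouteNonsingularPartDivisible
import Literature.NumberTheory.EllipticCurves.KernelReductionDivisibleProofs
import Literature.NumberTheory.EllipticCurves.GeomPointReduction
import Literature.NumberTheory.EllipticCurves.PointDivisibilityProofs
import HarnessLib

/-!
# Class X11b, route p2: the local divisibility `(LocDiv)` — `E₀(K̄_v)` is `p`-divisible on its
# `p`-power torsion at every finite place `v ∤ p` (good / multiplicative / additive reduction), and
# Greenberg's Lemma 3.3 with the Tamagawa bound `#ker r_v ≤ c_v^{(p)}` UNCONDITIONALLY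
# (cell `b2b-bsdres`, sub-cell `multr1-p2`, gen 14)

HONEST FRAMING (verbatim, cell `b2b-bsdres`): the goal of the cell is to DELETE the
COMBINATION-SHAPED residual classes for ALL analytic-rank `≤ 1` curves over `ℚ` — "full BSD
formula for every rank `≤ 1` curve in class `C`" assembled STRICTLY from published theorems — so
that the rank-`≤ 1` remainder becomes exactly the CONSTRUCTION-SHAPED classes, which are TYPED
(missing-input Props), NOT attempted; this is not "finishing BSD". Research route `p2` for class
X11b; no claim beyond the stated class; nothing booked; X11b stays CONSTRUCTION-SHAPED. Theorems
only; no definition, no named fact, no `sorry`.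

## Content

* **`localDivisible_nonsingular_torsion`** — `(LocDiv)` at every finite place `v` with `p ∈ 𝓞_v^×`:
  on the minimal model `X` at `v`, every point of `X(K̄_v)` with non-singular reduction (for the
  spectral valuation `|·|_v`) and `p`-power order is `p • Q'` for some `Q'` with non-singular
  reduction. By the reduction type of the minimal model (Silverman *AEC* VII.2.1, VII.5.1; *ATAEC*
  IV.9 Remark 9.2.2):
  - good (`Δ ∈ 𝓞_v^×`): every point has non-singular reduction (`hasNonsingularReduction_of_isUnit_Δ`)
    and `X(K̄_v)` is divisible (`nsmul_surjective_of_isAlgClosed`);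
  - multiplicative (`Δ ∈ 𝓂_v`, `c₄ ∈ 𝓞_v^×`; the reduction over `𝒪_w` is a node): the reduction
    `r : E₀(K̄_v) ↠ k̄_w^×` is onto with kernel `E₁` (Hensel over the henselian `𝒪_w` with
    algebraically closed residue field, `exists_addMonoidHom_units_of_node_of_isAlgClosed`), `k̄_w^×`
    has `p`-th roots, and `E₁(K̄_v)` is `p`-divisible (`exists_zsmul_eq_of_one_lt_val`, *AEC* IV.2.3);
  - additive (`Δ, c₄ ∈ 𝓂_v`; a cusp): `E₀(K̄_v)` has no prime-to-`v` torsion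
    (`eq_zero_of_zsmul_eq_zero_of_cusp`), so `Q = O`.
* **`natCard_localKer_le_pow_padicValNat_localTamagawaNumber`** — GREENBERG'S LEMMA 3.3 AT A BAD
  PLACE WITH THE TAMAGAWA BOUND, unconditionally: for an elliptic curve `E` over a number field `K`,
  a `ℤ_p`-extension `κ` and a finite place `v ∤ p`, `ker r_v = ker (H¹(K_v, E[p^∞]) → H¹(K_{∞,w}, E[p^∞]))`
  (`localKer (ker κ) E[p^∞] v`) is finite with `#ker r_v ≤ p ^ ord_p c_v(E/K)` (Greenberg, LNM 1716,
  §3 Lemma 3.3 p. 87 and §4 proof of Thm. 4.1 p. 74: "`ker r_v` has order `c_v^{(p)}`"; here `≤`).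
  Every input is a theorem of the tree; `#print axioms` standard.

Consequence for route p2 (next file): hypothesis (c) of `controlUpperOnTreeAt_of_nPlus_bounds`
(`BDPRouteControlBadPlaces`) holds with `b v = ord_p c_v(E_K)`. CONDITIONAL use downstream only;
nothing booked; reach and labels unchanged.

References: [GreenbergLNM1716] §3 Lemma 3.3 (p. 87), §4 proof of Thm. 4.1 (p. 74);
[SilvermanAEC2009] VII.2.1, VII.3.1, VII.5.1, IV.2.3, VIII.§2; [SilvermanATAEC1994] IV.9 Remark 9.2.2.
-/

noncomputable section

open scoped Classical NNReal

open NumberField IsDedekindDomain Field IsDedekindDomain.HeightOneSpectrum WeierstrassCurve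
open Literature.NumberTheory.EllipticCurves Literature.NumberTheory.EllipticCurves.GreenbergSelmer
open Literature.NumberTheory.GaloisRepresentations

universe u

namespace Summit.BirchSwinnertonDyer.Rank1Residual.X11b.AcSelmer

variable {K : Type u} [Field K] [NumberField K]

/-! ## `(LocDiv)`: the `p`-power torsion with non-singular reduction is `p`-divisible inside `E₀(K̄_v)` -/

section LocDiv

/-- **`(LocDiv)` at every finite place where `p` is a unit.** For an elliptic curve `E` over a number
field `K`, a finite place `v`, a prime `p` with `p ∈ 𝓞_v^×`, the spectral valuation `w = |·|_v` on
`K̄_v`, and the minimal model `X = M ⊗ K_v` at `v`: every `Q ∈ X(K̄_v)` with non-singular reduction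
and `p`-power order is `p • Q'` with `Q'` of non-singular reduction (the inertia-fixed hypothesis of
`(LocDiv)` is not even needed). Case analysis on the reduction of `M`: good — all of `X(K̄_v)`, a
divisible group; multiplicative — `E₀(K̄_v)/E₁(K̄_v) ≅ k̄_w^×` by Hensel and `E₁(K̄_v)` is
`p`-divisible; additive — `E₀(K̄_v)` has no prime-to-`v` torsion. [cite: SilvermanAEC2009, VII.§2 Prop. 2.1, Prop. VII.5.1, Prop. VII.3.1, VIII.§2]
[cite: SilvermanATAEC1994, IV.9 Remark 9.2.2 (PDF p. 340)] -/
theorem localDivisible_nonsingular_torsion (W : WeierstrassCurve K) [W.IsElliptic]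
    (v : HeightOneSpectrum (𝓞 K)) {p : ℕ} [Fact p.Prime] (hpv : (p : 𝓞 K) ∉ v.asIdeal)
    (w : Valuation (AlgebraicClosure (v.adicCompletion K)) ℝ≥0)
    (hw : ∀ x, (w x : ℝ) =
      spectralNorm (v.adicCompletion K) (AlgebraicClosure (v.adicCompletion K)) x)
    (𝔐 : Ideal v.localAbsIntegers) (_h𝔐 : 𝔐 ∈ v.localPrimesAbove)
    (Q : (((W.localMinimalIntegralModel v).map (algebraMap (v.adicCompletionIntegers K)
        (v.adicCompletion K))).baseChange (AlgebraicClosure (v.adicCompletion K))).toAffine.Point)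
    (_hfix : ∀ σ ∈ 𝔐.inertia (absoluteGaloisGroup (v.adicCompletion K)),
        Affine.Point.map ((absoluteGaloisGroup.toAlgEquiv _ σ :
            AlgebraicClosure (v.adicCompletion K) ≃ₐ[v.adicCompletion K]
              AlgebraicClosure (v.adicCompletion K)) :
            AlgebraicClosure (v.adicCompletion K) →ₐ[v.adicCompletion K]
              AlgebraicClosure (v.adicCompletion K)) Q = Q)
    (hQ : ReducesToNonsingular w (IsLocalRing.residue w.integer) Q) (hQtors : ∃ k : ℕ, p ^ k • Q = 0) :
    ∃ Q', ReducesToNonsingular w (IsLocalRing.residue w.integer) Q' ∧ p • Q' = Q := by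
  have hpp : (p : ℕ).Prime := Fact.out
  obtain ⟨𝔐, h𝔐⟩ := v.localPrimesAbove_nonempty
  obtain ⟨k, hk⟩ := hQtors
  -- the minimal model, its base change `V = X ⊗ K̄_v`, an `𝒪_w`-model `W₀`
  let M := W.localMinimalIntegralModel v
  have hv0 : w.Integers w.integer := Valuation.integer.integers w
  haveI hint := WeierstrassCurve.isIntegral_spectralValuation_baseChange hw M
  haveI : ((M.map (algebraMap (v.adicCompletionIntegers K) (v.adicCompletion K))).baseChange
      (AlgebraicClosure (v.adicCompletion K))).IsElliptic :=
    W.isElliptic_baseChange_map_localMinimalIntegralModel (v := v)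
  obtain ⟨W₀, hW₀⟩ := hint.integral
  haveI : (W₀.baseChange (AlgebraicClosure (v.adicCompletion K))).IsElliptic := by
    rw [← hW₀]; infer_instance
  have hp : IsUnit ((p : ℕ) : v.adicCompletionIntegers K) := by
    have h := isUnit_algebraMap_adicCompletionIntegers K v hpv
    rwa [map_natCast] at h
  have hwp : w ((p : ℤ) : AlgebraicClosure (v.adicCompletion K)) = 1 := by
    rw [Int.cast_natCast, spectralValuation_natCast_eq_one_of_isUnit hw hp]
  have hwpk : w ((((p : ℕ) ^ k : ℕ) : ℤ) : AlgebraicClosure (v.adicCompletion K)) = 1 := by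
    rw [Int.cast_natCast, Nat.cast_pow, map_pow, spectralValuation_natCast_eq_one_of_isUnit hw hp,
      one_pow]
  -- `E₀` membership transported to `W₀`
  have hE₀ : ∀ P, ReducesToNonsingular w (IsLocalRing.residue w.integer) P ↔
      W₀.HasNonsingularReduction (Affine.Point.congrEquiv hW₀ P) := fun P ↦ by
    rw [← reducesToNonsingular_iff_hasNonsingularReduction W₀, reducesToNonsingular_congrEquiv_iff _ hW₀]
  have hQ₀ := (hE₀ Q).mp hQ
  -- the coefficients of `W₀` are those of `M`
  have hcoef : ∀ {a : v.adicCompletionIntegers K} {b : w.integer},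
      algebraMap w.integer (AlgebraicClosure (v.adicCompletion K)) b =
        algebraMap (v.adicCompletion K) (AlgebraicClosure (v.adicCompletion K))
          (algebraMap (v.adicCompletionIntegers K) (v.adicCompletion K) a) →
      (¬ IsUnit a → IsLocalRing.residue w.integer b = 0) ∧
        (IsUnit a → IsLocalRing.residue w.integer b ≠ 0) := by
    intro a b hab
    constructor
    · intro ha
      have hmem : a ∈ IsLocalRing.maximalIdeal (v.adicCompletionIntegers K) := ha
      rw [← v_algebraMap_lt_one_iff hv0, hab]
      exact spectralValuation_algebraMap_lt_one_of_mem_maximalIdeal hw h𝔐 hmem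
    · intro ha
      rw [← v_algebraMap_eq_one_iff hv0, hab]
      exact spectralValuation_eq_one_of_isUnit hw ha
  have hΔeq : algebraMap w.integer (AlgebraicClosure (v.adicCompletion K)) W₀.Δ =
      algebraMap (v.adicCompletion K) (AlgebraicClosure (v.adicCompletion K))
        (algebraMap (v.adicCompletionIntegers K) (v.adicCompletion K) M.Δ) := by
    rw [← map_Δ, ← map_Δ, ← map_Δ]
    change (W₀.baseChange (AlgebraicClosure (v.adicCompletion K))).Δ =
      ((M.map (algebraMap (v.adicCompletionIntegers K) (v.adicCompletion K))).baseChange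
        (AlgebraicClosure (v.adicCompletion K))).Δ
    rw [hW₀]
  have hc₄eq : algebraMap w.integer (AlgebraicClosure (v.adicCompletion K)) W₀.c₄ =
      algebraMap (v.adicCompletion K) (AlgebraicClosure (v.adicCompletion K))
        (algebraMap (v.adicCompletionIntegers K) (v.adicCompletion K) M.c₄) := by
    rw [← map_c₄, ← map_c₄, ← map_c₄]
    change (W₀.baseChange (AlgebraicClosure (v.adicCompletion K))).c₄ =
      ((M.map (algebraMap (v.adicCompletionIntegers K) (v.adicCompletion K))).baseChange
        (AlgebraicClosure (v.adicCompletion K))).c₄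
    rw [hW₀]
  by_cases hΔ : IsUnit M.Δ
  · -- GOOD reduction: `E₀ = X(K̄_v)`, a divisible group
    have hΔ₀ : IsUnit W₀.Δ := by
      rw [Valuation.Integers.isUnit_iff_valuation_eq_one hv0, hΔeq]
      exact spectralValuation_eq_one_of_isUnit hw hΔ
    obtain ⟨Q', hQ'⟩ := ((M.map (algebraMap (v.adicCompletionIntegers K)
      (v.adicCompletion K))).baseChange (AlgebraicClosure (v.adicCompletion K)))
        |>.nsmul_surjective_of_isAlgClosed hpp.ne_zero Q
    exact ⟨Q', (hE₀ Q').mpr (hasNonsingularReduction_of_isUnit_Δ hv0 hΔ₀ _), hQ'⟩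
  · have hΔ₀ : IsLocalRing.residue w.integer W₀.Δ = 0 := (hcoef hΔeq).1 hΔ
    by_cases hc₄ : IsUnit M.c₄
    · -- MULTIPLICATIVE reduction: `E₀/E₁ ≅ k̄^×` (Hensel) and `E₁` is `p`-divisible
      have hc₄₀ : IsLocalRing.residue w.integer W₀.c₄ ≠ 0 := (hcoef hc₄eq).2 hc₄
      haveI := henselianRing_integer w
      haveI := isAlgClosed_residueField_integer w
      obtain ⟨r, hrsurj, hrker⟩ := W₀.exists_addMonoidHom_units_of_node_of_isAlgClosed hv0 hΔ₀ hc₄₀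
      set Q₀ := Affine.Point.congrEquiv hW₀ Q with hQ₀def
      -- a `p`-th root of `r(Q₀)` in `k̄^×`, lifted to `E₀`
      set u : Additive (IsLocalRing.ResidueField w.integer)ˣ := r ⟨Q₀, hQ₀⟩ with hu
      obtain ⟨z, hz⟩ := IsAlgClosed.exists_pow_nat_eq ((Additive.toMul u : (IsLocalRing.ResidueField
        w.integer)ˣ) : IsLocalRing.ResidueField w.integer) hpp.pos
      have hz0 : z ≠ 0 := by
        intro h; rw [h, zero_pow hpp.ne_zero] at hz
        exact (Additive.toMul u).ne_zero hz.symm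
      let u' : Additive (IsLocalRing.ResidueField w.integer)ˣ := Additive.ofMul (Units.mk0 z hz0)
      have hu' : p • u' = u := by
        apply Additive.toMul.injective
        rw [toMul_nsmul]
        ext
        change ((Units.mk0 z hz0) ^ p : (IsLocalRing.ResidueField w.integer)ˣ).val = _
        rw [Units.val_pow_eq_pow_val, Units.val_mk0, hz]
      obtain ⟨a, ha⟩ := hrsurj u'
      -- `D = p • a − Q₀ ∈ E₁`
      have hDmem : p • (a : (W₀.baseChange (AlgebraicClosure (v.adicCompletion K))).toAffine.Point) -
          Q₀ ∈ W₀.nonsingularReductionSubgroup hv0 :=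
        sub_mem (AddSubgroup.nsmul_mem _ a.2 p) hQ₀
      have hrD : r ⟨_, hDmem⟩ = 0 := by
        have e : (⟨_, hDmem⟩ : W₀.nonsingularReductionSubgroup hv0) = p • a - ⟨Q₀, hQ₀⟩ :=
          Subtype.ext rfl
        rw [e, map_sub, map_nsmul, ha, hu', hu, sub_self]
      have hD0 : W₀.ReducesToZero (p • (a : (W₀.baseChange
          (AlgebraicClosure (v.adicCompletion K))).toAffine.Point) - Q₀) := (hrker _).mp hrD
      -- `E₁` is `p`-divisible: `D = p • c` with `c ∈ E₁`
      obtain ⟨c, hcE₀, hc⟩ : ∃ c : (W₀.baseChange (AlgebraicClosure (v.adicCompletion K))).toAffine.Point,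
          W₀.HasNonsingularReduction c ∧ p • c = p • (a : (W₀.baseChange
            (AlgebraicClosure (v.adicCompletion K))).toAffine.Point) - Q₀ := by
        rcases point_cases hv0 (p • (a : (W₀.baseChange
            (AlgebraicClosure (v.adicCompletion K))).toAffine.Point) - Q₀) with
          h0 | ⟨x, y, hxy, hD, hx⟩ | ⟨a', b', hab, hD⟩
        · exact ⟨0, WeierstrassCurve.hasNonsingularReduction_zero, by rw [h0]; exact nsmul_zero p⟩
        · haveI : (W₀.baseChange (AlgebraicClosure (v.adicCompletion K))).IsIntegral w.integer :=
            ⟨W₀, rfl⟩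
          obtain ⟨x', y', h', hx', hc⟩ := exists_zsmul_eq_of_one_lt_val
            (V := W₀.baseChange (AlgebraicClosure (v.adicCompletion K))) hwp hxy hx
          refine ⟨.some x' y' h', ((WeierstrassCurve.reducesToZero_some_iff h').mpr
            ((not_mem_range_iff hv0).mpr hx')).hasNonsingularReduction, ?_⟩
          rw [hD, ← hc, natCast_zsmul]
        · exfalso
          rw [hD] at hD0
          exact ((WeierstrassCurve.reducesToZero_some_iff hab).mp hD0) ⟨a', rfl⟩
      -- `Q' = a − c`
      refine ⟨(Affine.Point.congrEquiv hW₀).symm ((a : (W₀.baseChange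
          (AlgebraicClosure (v.adicCompletion K))).toAffine.Point) - c), ?_, ?_⟩
      · rw [hE₀, AddEquiv.apply_symm_apply]
        exact (W₀.nonsingularReductionSubgroup hv0).sub_mem a.2 hcE₀
      · apply (Affine.Point.congrEquiv hW₀).injective
        rw [map_nsmul, AddEquiv.apply_symm_apply, smul_sub, hc, sub_sub_cancel]
    · -- ADDITIVE reduction: `E₀(K̄_v)` has no prime-to-`v` torsion, so `Q = O`
      have hc₄₀ : IsLocalRing.residue w.integer W₀.c₄ = 0 := (hcoef hc₄eq).1 hc₄
      have hQ0 : Affine.Point.congrEquiv hW₀ Q = 0 :=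
        W₀.eq_zero_of_zsmul_eq_zero_of_cusp hΔ₀ hc₄₀ hwpk hQ₀
          (by rw [natCast_zsmul, ← map_nsmul, hk, map_zero])
      have hQ0' : Q = 0 := (Affine.Point.congrEquiv hW₀).injective (by rw [hQ0, map_zero])
      exact ⟨0, reducesToNonsingular_zero, by rw [hQ0', smul_zero]⟩

end LocDiv

/-! ## Greenberg's Lemma 3.3 with the Tamagawa bound, unconditionally -/

section Bound

/-- **Greenberg's Lemma 3.3 at a place `v ∤ p`, with the Tamagawa bound: `#ker r_v ≤ c_v^{(p)}`.**
For an elliptic curve `E` over a number field `K`, a prime `p`, a `ℤ_p`-extension `κ` of `K`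
(`K_∞ = K̄^{ker κ}`) and a finite place `v ∤ p`, Greenberg's local kernel
`ker r_v = ker (H¹(K_v, E[p^∞]) → H¹(K_{∞,w}, E[p^∞]))` at the chosen place `w ∣ v`
(`localKer (ker κ) E[p^∞] v`) is finite and `#ker r_v ≤ p ^ ord_p c_v(E/K)`, `c_v` the local Tamagawa
number (R. Greenberg, *Iwasawa theory for elliptic curves*, LNM 1716, §3 Lemma 3.3 (p. 87) with the
computation in the proof of Thm. 4.1 (p. 74): "`ker r_v` has order `c_v^{(p)}`"; the inequality is
what the control theorem's upper bound uses). ALL inputs are theorems of the tree: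
`natCard_localKer_le_pow_padicValNat_localTamagawaNumber_of_localDivisible` and
`localDivisible_nonsingular_torsion`. [cite: GreenbergLNM1716, §3 Lemma 3.3 (p. 87) and §4 proof of Thm. 4.1 (p. 74)]
[cite: SilvermanAEC2009, Thm. VII.6.1 / Cor. VII.6.2, VII.2.1, VII.3.1] -/
theorem natCard_localKer_le_pow_padicValNat_localTamagawaNumber
    (W : WeierstrassCurve K) [W.IsElliptic] {p : ℕ} [Fact p.Prime] (κ : ZpExtension K p)
    {v : HeightOneSpectrum (𝓞 K)} (hpv : (p : 𝓞 K) ∉ v.asIdeal) :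
    Finite (localKer κ.kerSubgroup (W.geomPrimaryTorsion p) v) ∧
      Nat.card (localKer κ.kerSubgroup (W.geomPrimaryTorsion p) v) ≤
        p ^ padicValNat p
          ((W.baseChange (v.adicCompletion K)).localTamagawaNumber (v.adicCompletionIntegers K)) :=
  natCard_localKer_le_pow_padicValNat_localTamagawaNumber_of_localDivisible W κ hpv
    (fun w hw 𝔐 h𝔐 Q hfix hQ hk ↦
      localDivisible_nonsingular_torsion W v hpv w hw 𝔐 h𝔐 Q hfix hQ hk)

end Bound

end Summit.BirchSwinnertonDyer.Rank1Residual.X11b.AcSelmer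

end
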